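import Summits.HodgeConjecture.HodgeConjecture.Theorems.F0P6aPELSpreadDefs
import Literature.AlgebraicGeometry.AbelianSchemes.PELTupleSpreadLocalisedOfLetter
import Literature.NumberTheory.NumberFields.PlaceResidueCharacteristicRows
import HarnessLib
import HarnessLib.Audit.LibrarySuggestionsDenyListCruxes

/-!
# `F0P6aStubGSPREAD` — ★ RE-HOME (K6, MAIN-stem row; heir LEAD F0P6-plan (g7) «M-149b», 2026-09-03) of the (A2) closer leaf `Lines/F0_P6a_StubGSPREAD.lean` — `gspread_of_line : DualPairOfAmpleRigidified → RecordESpreadCofinal`, SORRY-FREE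

This `Theorems/` module is the TREE BYTES of `Summits/HodgeConjecture/HodgeConjecture/Cruxes/HLiu418/Lines/F0_P6a_StubGSPREAD.lean` (edition of record ED. 1, tree sha16 81473cadd2ed4a79, 106 l.) with the
NAMESPACE KEPT — `Summit.HodgeConjecture.HodgeConjecture.Cruxes.HLiu418.F0P6aStubGSPREAD` — so the one fully-qualified name MAIN reads, `…F0P6aStubGSPREAD.gspread_of_line`, is UNCHANGED;
the options∕`open` preamble (:32–:63), the head՚s docstring (:66–:71) and its tactic body (:73–:94) are VERBATIM.  Edits, exactly: (i) the header is CANONICAL (bare `import` lines; «M-142a» (A)) with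
l.1 `Lines.F0_P6a_PELSpread` → ★ `Theorems.F0P6aPELSpreadDefs` and the «P-κ» carrier added (root part); (ii) the HEAD IS RE-STATED from `type_of% @F0P6aPELSpread.stub_GSPREAD` to the letters
`DualPairOfAmpleRigidified → RecordESpreadCofinal` (P-side order of record, LAref-P #47 2026-09-02T21:42Z; = the hub socket՚s printed type, ED. 2 :99, so the elaborated statement is unchanged —
LA4-r01 #107 type-hash row `stub_GSPREAD` T=1851759045 = `gspread_of_line`); (iii) the SAME-STATEMENT tie `example : type_of% @F0P6aPELSpread.stub_GSPREAD := @gspread_of_line` (:96–:97) is NOT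
re-homed — its pin is the `Lines` hub socket; the live tie is MAIN :654 `spread_of_parts F0P6aStubGSPREAD.gspread_of_line stub_INJ0 …` elaborating through the shim; (iv) `spread_of_line_of_gspread` (:99–:102)
is RETIRED («M-142e» (ii)): its body instantiates the hub socket `stub_ELAWS` (`sorry`) and it has 0 callers anywhere — not re-homable sorry-free, so deleted, no alias (booked retirement (r7)).
Why a re-home: a `Theorems/` file cannot import a `Lines/` workfile (F0P6-ref1 o-6), and MAIN՚s own ★ twin (wave 3∕4) must read this head from `Theorems/`.  After this file is ★ the `Lines`
leaf becomes a one-import SHIM (`import …Theorems.F0P6aStubGSPREAD` + `HarnessLib` + carrier; writer «L7» LA7-plan on the LEAD՚s wave word).  It asserts nothing beyond what the leaf already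
proves: `--axioms gspread_of_line` = [propext, Classical.choice, Quot.sound].  HC_CM is proved only modulo the 7 printed citations (2 remaining: hLiu418 = stmt-HodgeConjecture-24832,
h413 = stmt-HodgeConjecture-24833) until rung 0 closes; a re-home is count-neutral.  (Cand: LA2-p03 (g7), generator `k6/mk_gspread.py`; box LAref-P (g5) first ∕ LA4-r01 (g5) second.)

## Import provenance (the workfile՚s header comments, moved here so that the header is CANONICAL)
- `Summits.HodgeConjecture.HodgeConjecture.Theorems.F0P6aPELSpreadDefs` — ★ K5-H3 «hub twin minus sockets» of `Lines.F0_P6a_PELSpread` (home of `RecordESpreadCofinal`∕`stageLocLeg`∕`IsStageLocalisationAt`∕`spread_of_parts`∕`stub_INJ0`; `DualPairOfAmpleRigidified` via its import ★ `Theorems.F0P6aPELInputs`)  ∕ was l.1: -- TREE L4 closer leaf ED. 1 4f143bbfae3e880b (desk F0P6a-plan (g4); (HI) BUILT): socket `stub_GSPREAD`, letter `RecordESpreadCofinal`, `stageLocLeg`, `IsStageLocalisationAt`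
- `Literature.AlgebraicGeometry.AbelianSchemes.PELTupleSpreadLocalisedOfLetter` — ★ p849094 (LA4-p03 (g2)) GSPREAD LAST MILE `IntegralModel.exists_stage_pelTuple_localised_rows_of_letter_thickening` (= ★ (H2) p849005 LA4-p01 + ★ (H1) p849039 LA4-p04∕LA4-p05, read at `𝓜.localise w`)
- `Literature.NumberTheory.NumberFields.PlaceResidueCharacteristicRows` — ★ p847908 (LA4-p01 (g0)) the arithmetic rows `pChar hpChar fDeg hpCharConj hfDeg charP₀` of `PELSpreadAt`
- `HarnessLib`
- `HarnessLib.Audit.LibrarySuggestionsDenyListCruxes` — «P-κ» (LEAD F0P6-plan (g6) «M-142d» (1)): ROOT part of a K6 ★ twin carries the `Cruxes` deny-list carrier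

## Original module docstring (verbatim)
# `F0_P6a_StubGSPREAD` — THE (A2) CLOSER LEAF ABOVE THE L4 LEAF: `gspread_of_line : type_of% @F0P6aPELSpread.stub_GSPREAD`, SORRY-FREE (ED. 1 cand v1, «L4» LA4-p03 (g2); desk F0P6a-plan (g4) SOCKET PLAN «P-SIDE AFTER M-66» (A2), LA4-plan (g0) DEAL #10)

CRUX `stmt-HodgeConjecture-24832` (HLiu418), sub-line P6a, line «L4».  SOCKET: the L4 closer leaf `Lines/F0_P6a_PELSpread.lean` ED. 1 `stub_GSPREAD`
(`DualPairOfAmpleRigidified → RecordESpreadCofinal`, :253 of 4f143bbfae3e880b) — THE EXISTENCE CORE OF THE SPREAD, ROAD (S♭) (LEAD «M-55» (b)): every PEL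
witness `E` over the generic fibre `X = (S.M Kc) ⊗_F Fᵢ` of GEN՚s model `𝓜` spreads, off a finite `S_t(E)`, at every split `w ∉ S_t`, to a localised
tuple-with-provenance `T : PELSpreadAt … w …` whose witness IS `E` and which IS the stage tuple localised along `stageLocLeg 𝓜 w t τ` (`IsStageLocalisationAt`).
This leaf pays it BY NAME, with NO organ of its own (zero in-file sockets): HEAD `gspread_of_line : type_of% @F0P6aPELSpread.stub_GSPREAD`, junction
`example : type_of% @F0P6aPELSpread.stub_GSPREAD := @gspread_of_line`.  Consumer ONE LEVEL UP (desk (A3), MAIN ED. 8):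
`stub_RGD := rgd_of_inputs (pel_of_inputs (spread_of_parts F0P6aStubGSPREAD.gspread_of_line stub_INJ0 F0P6aStubGEN.elaws_of_line) stub_DUALS) (datum_of_inputs …)`.

THE PROOF (record packaging, 27 lines; every organ ★): per letter context and witness `E`, the LAST-MILE organ ★ p849094
`IntegralModel.exists_stage_pelTuple_localised_rows_of_letter_thickening (S.M.obj Kc) 𝓜 (S.projective Kc) hD (Module.finBasis ℤ (𝓞 F)) E.P.A E.ρ E.P.D E.P.pol
E.P.hasType E.P.level E.P.relDim (fun b b' => (b' : F) = c b) E.rosati` — composed of ★ (H2) `IntegralModel.exists_stage_pelTuple_rows_cofinite_of_stageDuals` (LA4-p01 (g0)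
p848968∕p849005: B-p18 (g39)՚s chain (1)–(7) [EGA IV₃ 8.8.2∕8.10.5] + the three stage rows Rosati ∕ quasi-inverse ∕ commutativity) and ★ (H1)
`AbelianSchemeOver.stageDuals_of_letter` (LA4-p04 (g0) p848931∕p849039 + LA4-p05 (g2) p849003: the DUALS letter ⇒ a dual pair on a stage restriction, [MumfordAV1970] §13)
read at `𝓜.localise w` — yields ONE stage tuple `(t, 𝒜ₜ, ρₜ, Dₜ, polₜ, lvlₜ)`, a finite `S_t ⊇ {w ∣ ∏ δᵢ}`, and at every `w ∉ S_t` a leg `τ` with the rows `relDim`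
`comm` `rosati` `polQuasiInv` (with `pChar.Coprime d`) of the base change along `stageLocLeg 𝓜 w t τ` and the generic reading `gen_iso` in `genIncl` currency; the
arithmetic rows of `w` are ★ p847908 `HeightOneSpectrum.exists_residueChar_rows_complexConj`; `T := { … }`, provenance `rfl, rfl, HEq.rfl`, `IsStageLocalisationAt` by
`⟨rfl, HEq.rfl, HEq.rfl, HEq.rfl, rfl, rfl, HEq.rfl⟩`.  Identical to the HOME by-import cert `F0/P6/L4/LA4-p03/g2/CERT-stubGSPREAD-paid.byimport.v1.LA4-p03g2.lean`
80220f48447ea1a4 (rc 0 ∕ sorries 0 ∕ TRIO on the served leaf olean).  Budgets: DEFAULT `maxHeartbeats`.  No instance, no notation, no `def`.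
HONEST LABEL: HC_CM is proved only modulo the 7 printed citations (2 remaining: hLiu418 = stmt-HodgeConjecture-24832, h413 = stmt-HodgeConjecture-24833) until rung 0 closes — count-neutral.
[cite: EGAIV3, Thm. 8.10.5 (p. 37); Thm. 8.8.2 (p. 28)] [cite: MumfordAV1970, §7 Thm. 4 (p. 72); §13 (pp. 123–125)] [cite: RapoportSmithlingZhang2020Diagonal, §4.1 Thm. 4.1 p. 17]
[cite: MumfordFogartyKirwan1994, Ch. 7 §2 Def. 7.2 p. 129] [cite: Kottwitz1992, §5 pp. 389–391]
-/

set_option autoImplicit false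

noncomputable section

-- Mathlib's `Over`∕pull-back API is stated across semireducible wrappers (as in the ★ `AbelianSchemes/*` stage files and the L4 leaf).
set_option backward.isDefEq.respectTransparency false

namespace Summit.HodgeConjecture.HodgeConjecture.Cruxes.HLiu418.F0P6aStubGSPREAD

set_option linter.dupNamespace false  -- `Summit.HodgeConjecture.HodgeConjecture.…` BY DESIGN (D-0017)

open CategoryTheory CategoryTheory.Limits NumberField IsDedekindDomain MulAction
open scoped Matrix Polynomial Pointwise
open Literature.NumberTheory.GaloisRepresentations
open Literature.NumberTheory.Automorphic Literature.NumberTheory.Automorphic.UnitaryGroup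
open Literature.AlgebraicGeometry.ShimuraVarieties.UnitaryCanonicalModel
open Literature.NumberTheory.Automorphic.Liu2021.AppendixC
open Literature.AlgebraicGeometry.Motives (AlgPoints IntegralModel SchemeOver thickening thickeningGalAction thickeningLift)
open Literature.NumberTheory.DiophantineGeometry (geomResidueField specialFibreFunctor)
open Literature.AlgebraicGeometry.RelativeSpec (ActionOver)
open Literature.NumberTheory.EllipticCurves (genericFibre)
open AlgebraicGeometry (QuasiCompact QuasiSeparated LocallyOfFinitePresentation Flat IsSeparated)
open Summit.HodgeConjecture.HodgeConjecture.Cruxes.HLiu418.F0P6aModuliDatumDefs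
open Summit.HodgeConjecture.HodgeConjecture.Cruxes.HLiu418.F0P6aRGDAssembly
open Summit.HodgeConjecture.HodgeConjecture.Cruxes.HLiu418.F0P6aPELWitnessE (PELWitnessE IsCMTypeThrough)
open Summit.HodgeConjecture.HodgeConjecture.Cruxes.HLiu418.F0P6aStubKOTT (KottAdaptedAt UnmixedAt)
open Summit.HodgeConjecture.HodgeConjecture.Cruxes.HLiu418.F0P6aPELInputs
open Summit.HodgeConjecture.HodgeConjecture.Cruxes.HLiu418.F0P6aPELSpread
open Literature.AlgebraicGeometry.Motives (specOver)
open Literature.AlgebraicGeometry.Limits.LocApprox (Idx baseDiagram)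
open MonoidalCategory

/-! ### §1 The head (no organs: every input is ★) -/

/-- **HEAD `gspread_of_line : type_of% @F0P6aPELSpread.stub_GSPREAD`** (= `DualPairOfAmpleRigidified → RecordESpreadCofinal`, SORRY-FREE) — THE EXISTENCE CORE OF
THE SPREAD, ROAD (S♭), PAID: record packaging over the last-mile organ ★ `IntegralModel.exists_stage_pelTuple_localised_rows_of_letter_thickening` (★ (H2)
`exists_stage_pelTuple_rows_cofinite_of_stageDuals` composed with ★ (H1) `stageDuals_of_letter`, read at `𝓜.localise w`) and the arithmetic rows ★
`HeightOneSpectrum.exists_residueChar_rows_complexConj`; the produced `T` IS the stage tuple base-changed along `stageLocLeg 𝓜 w t τ` (`IsStageLocalisationAt` by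
`rfl`∕`HEq.rfl`). [cite: EGAIV3, Thm. 8.10.5 (p. 37); Thm. 8.8.2 (p. 28)] [cite: MumfordAV1970, §7 Thm. 4 (p. 72); §13 (pp. 123–125)]
[cite: RapoportSmithlingZhang2020Diagonal, §4.1 Thm. 4.1 p. 17] [cite: MumfordFogartyKirwan1994, Ch. 7 §2 Def. 7.2 p. 129] -/
theorem gspread_of_line : DualPairOfAmpleRigidified → RecordESpreadCofinal := by
  intro hD F _ _ _ _ ι₁ Jstar K₀ S hU7ₛ hJ hJu Fi _ _ _ Kc G _ 𝓜 hqc hqs hlfp hfl hsep τE hτE Φ hΦ E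
  haveI := hqc; haveI := hqs; haveI := hlfp; haveI := hfl; haveI := hsep
  haveI : NeZero E.N := ⟨by have := E.hδN.2; omega⟩
  haveI := S.smooth Kc
  obtain ⟨t, 𝒜ₜ, ρₜ, Dₜ, polₜ, lvlₜ, S_t, hS_t, hgood⟩ :=
    Literature.AlgebraicGeometry.Motives.IntegralModel.exists_stage_pelTuple_localised_rows_of_letter_thickening (S.M.obj Kc) 𝓜
      (S.projective Kc) hD (Module.finBasis ℤ (𝓞 F)) E.P.A E.ρ E.P.D E.P.pol E.P.hasType E.P.level E.P.relDim
      (fun b b' : 𝓞 F => (b' : F) = (IsCMField.complexConj F) (b : F)) E.rosati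
  refine ⟨t, 𝒜ₜ, ρₜ, Dₜ, polₜ, lvlₜ, S_t, hS_t, fun w hwS => ?_⟩
  obtain ⟨τ, hrel, hcomm, hros, hq, hgen⟩ := hgood w hwS
  refine ⟨τ, fun hw h𝓨 θ e hΦw hΦu => ?_⟩
  obtain ⟨pChar, hpChar, fDeg, hpCharConj, hfDeg, charP₀⟩ :=
    Literature.NumberTheory.NumberFields.HeightOneSpectrum.exists_residueChar_rows_complexConj w
  refine ⟨{ τE := τE, hτE := hτE, Φ := Φ, hΦ := hΦ, hΦw := hΦw, hΦu := hΦu, E := E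
            univ := 𝒜ₜ.baseChange (stageLocLeg 𝓜 w t τ), act := ρₜ.baseChange (stageLocLeg 𝓜 w t τ)
            dual := Dₜ.baseChange (stageLocLeg 𝓜 w t τ), pol := polₜ.baseChange (stageLocLeg 𝓜 w t τ)
            lvl := lvlₜ.baseChange (stageLocLeg 𝓜 w t τ)
            relDim := hrel, comm := hcomm, rosati := hros
            pChar := pChar, hpChar := hpChar, fDeg := fDeg, hpCharConj := hpCharConj, hfDeg := hfDeg, charP₀ := charP₀
            polQuasiInv := hq pChar hpChar.1 hpChar.2
            gen_iso := fun e' y => hgen (thickeningLift e' (S.M.obj Kc) y).left }, rfl, rfl, HEq.rfl, ?_⟩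
  exact ⟨rfl, HEq.rfl, HEq.rfl, HEq.rfl, rfl, rfl, HEq.rfl⟩

/-! SAME-STATEMENT TIE `example : type_of% @F0P6aPELSpread.stub_GSPREAD := @gspread_of_line` (tree :96–:97) — NOT RE-HOMED: its pin is the `Lines` hub socket `stub_GSPREAD`; it stays hub-side
(the `Lines/F0_P6a_StubGSPREAD.lean` shim∕the hub ED. 2), where `type_of%` of the socket is in scope.  The statement identity is carried ★-side by the letters themselves (same Π-type) and by
MAIN :654 `spread_of_parts F0P6aStubGSPREAD.gspread_of_line stub_INJ0 …`. -/

/-! RETIRED (tree :99–:102) `theorem spread_of_line_of_gspread : DualPairOfAmpleRigidified → RecordPELSpreadCofinal := spread_of_parts gspread_of_line stub_INJ0 stub_ELAWS` — it instantiates the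
hub socket `stub_ELAWS` (`sorry`), so it cannot live in a `Theorems/` file; 0 callers anywhere (`rg spread_of_line_of_gspread lean/` = its own line); MAIN ED. 8∕10 substitutes both organs BY NAME
(`spread_of_parts F0P6aStubGSPREAD.gspread_of_line stub_INJ0 F0P6aStubGEN.elaws_of_line`).  «M-142e» (ii): deleted, no alias; retirement (r7) for LA-ref2՚s `diffK6.py --retired` list. -/

end Summit.HodgeConjecture.HodgeConjecture.Cruxes.HLiu418.F0P6aStubGSPREAD

end
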